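import Mathlib
import Literature.AlgebraicGeometry.Resolution.PointBlowupFlagInvariant
import Literature.AlgebraicGeometry.Resolution.PointBlowupFlagMaximalShift

/-!
# `WeightedInvariant.LocalWeightedDrop`, line `hasse-ridge-face-selection`, piece S3πM: the Hauser–Perlega FLAG INVARIANT of a
# purely inseparable surface position `y^q + A(x₁,x₂)` — DEFINITIONS (game side)

Crux item stmt-ResolutionOfSingularities-8899 `LocalWeightedDrop` (route `ResolutionOfSingularities/WeightedInvariant`), serving the
door `WeightedConstruction` stmt-ResolutionOfSingularities-0571.  [OURS · L1 W4.3, chain w43, stub worker 1 (gen 3).  Objects the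
engine line posits for the MEASURE of the descent lift `WildPurePower.purePower_won_of_descent₃`; not a statement of any manuscript.
The printed source of the construction is H. Hauser, S. Perlega, *Resolving surface singularities in positive characteristic*,
Publ. RIMS **60** (2024) §§4–5 (residual order, flags, `(d_𝓕, n_𝓕, s_𝓕)`, the resolution invariant as the maximum over flags);
the power-series bookkeeping (`cleanSeries`, `divMonomial`, `rowOrder`, `coeffIdealOrder`, `ordAlong`, `wOrder`, `initialPart`,
`Triple`) is REUSED from `Literature/…/PointBlowupFlagInvariant`.]

A STATE of the descent is a pair `(A, E)`: the coefficient `A ∈ k[[x,y]]` (`x = X 0`, `y = X 1`) of the germ `y^q + A` and the set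
`E ⊆ {0,1}` of EXCEPTIONAL LETTERS (bookkeeping of the strategy: which coordinate lines are exceptional curves through the point).
Everything is read on the CLEANED coefficient `B = cleanSeries q A` (no monomial with exponent in `q·ℕ²`; `A ≡ B` modulo `q`-th
powers, and re-centring `y ↦ y − φ` is a free move).  A FLAG in the first orientation is a shift `h ∈ k[[X]]`, `h(0) = 0`, standing
for the curve `F₁ = V(y + h(x))` with subordinate parameters `(x, y₁ = y + h(x))`; its EXPANSION is `cleanSeries q (B(x, y₁ − …))`,
precisely `cleanSeries q (subst (shift h) B)` with the substitution `y ↦ y + h(x)` of `PointBlowupFlagMaximalShift` (so that the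
series-level Lemma 3 / Prop 3 of that file apply by `rfl`).  The second orientation (curve `V(x + h(y))`, rows in `y`) is the first
orientation of the LETTER SWAP `(swap B, swapE E)`; all state-level notions are the union over both orientations, hence symmetric
under the swap BY CONSTRUCTION (`isFlagTriple_swap`, `termSub_swap`).

* classification (p. 783–784): `IsN0 E h` (`y ∉ E`, or `h = 0`: case `n_𝓕 = 0`), `IsTangent E h` (`y ∈ E`, `h ≠ 0`, and
  `ord h ≥ 2` or `x ∈ E`: case `n_𝓕 = ord h ≥ 1`; the datum `y ∈ E, ord h = 1, x ∉ E` is the transversal curve already listed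
  as an `n = 0` flag of the other orientation and is NOT admissible here);
* `excExp B E`, `dRes B E` (p. 776: `B = M·G`, `d_res = ord G`), `sFlag q B E h` (p. 783: `s_𝓕`, companion-ideal reading for
  `0 < d < q`), `weights n`, `dcurv`, `dFlag` (p. 784), `flagTriple q B E h ∈ Triple = ℕ ×ₗ ℕ ×ₗ ℕ∞`;
* `IsFlagTriple q B E v` — `v` is the triple of an admissible flag of either orientation; `IsTermShape q C` — the literal
  terminal shapes of the game's terminal exit (monomial / small residual, hypothesis `hterm` of the lift); `TermSub q B` — some
  triangular change of either orientation makes the cleaned expansion terminal;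
* `embed : Triple → Ordinal` (`(d,n,s) ↦ ω²·d + ω·n + s`, `s = ∞ ↦ ω`) and the MEASURE
  `measure q A E = 0` if `TermSub q (cleanSeries q A)`, else `(⨆ over flag triples of embed) + 1`.
The descent (measure drops along the normalised point-blow-up successors of the lift) is proved in the sequel files from
[HP24, Prop. 3] (attainment) and [HP24, Prop. 4] (drop).
-/

set_option linter.dupNamespace false -- mandated namespace of this single-conjunct summit

namespace Summit.ResolutionOfSingularities.ResolutionOfSingularities.Theorems

open Literature.AlgebraicGeometry.Resolution
open Literature.AlgebraicGeometry.Resolution.HauserPerlega2024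

namespace PurePowerFlag

open MvPowerSeries

variable {k : Type} [Field k]

/-! ### Shifts, expansions, the letter swap -/

/-- The triangular substitution `x ↦ x`, `y ↦ y + h(x)` of the plane `k[[x,y]]` (`x = X 0`, `y = X 1`): the subordinate parameters of
the flag `F₁ = V(y₁)`, `y₁ = y + h(x)`, are read off by expanding in `(x, y₁)`.  Literally the family of `PointBlowupFlagMaximalShift`
(`fun l => if l = y then X y + h(X x) else X l`). [HP24 Lemma 1 p. 788: "x₁ = x, y₁ = y + h(x)"] -/
noncomputable def shift (h : PowerSeries k) : Fin 2 → MvPowerSeries (Fin 2) k :=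
  fun l => if l = (1 : Fin 2) then
    (X (1 : Fin 2) : MvPowerSeries (Fin 2) k) + PowerSeries.subst (X (0 : Fin 2) : MvPowerSeries (Fin 2) k) h
    else X l

/-- The CLEANED EXPANSION of `B` along the flag `h`: `cleanSeries q (B(x, y + h(x)))`. [HP24 §5 p. 783: "F … of clean expansion"
in parameters subordinate to the flag] -/
noncomputable def expansion (q : ℕ) (B : MvPowerSeries (Fin 2) k) (h : PowerSeries k) : MvPowerSeries (Fin 2) k :=
  cleanSeries q (subst (shift h) B)

/-- The LETTER SWAP `x ↔ y` of a plane series. -/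
noncomputable def swap (B : MvPowerSeries (Fin 2) k) : MvPowerSeries (Fin 2) k :=
  rename (Equiv.swap (0 : Fin 2) 1) B

/-- The letter swap of a set of exceptional letters. -/
def swapE (E : Finset (Fin 2)) : Finset (Fin 2) := E.map (Equiv.swap (0 : Fin 2) 1).toEmbedding

/-- Orientation selector: `orient false B = B`, `orient true B = swap B`. -/
noncomputable def orient (o : Bool) (B : MvPowerSeries (Fin 2) k) : MvPowerSeries (Fin 2) k := if o then swap B else B

/-- Orientation selector on exceptional letters. -/
def orientE (o : Bool) (E : Finset (Fin 2)) : Finset (Fin 2) := if o then swapE E else E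

/-! ### Classification of flags [HP24 §5 pp. 783–784] -/

/-- Case `n_𝓕 = 0` in the first orientation: the curve `V(y + h(x))` is transversal to every exceptional coordinate line through the
point, or IS the exceptional line `V(y)` (`h = 0`). [HP24 §5 (i) p. 783] -/
def IsN0 (E : Finset (Fin 2)) (h : PowerSeries k) : Prop := (1 : Fin 2) ∉ E ∨ h = 0

/-- Case `n_𝓕 ≥ 1` in the first orientation: `V(y)` is exceptional and `V(y + h(x))`, `h ≠ 0`, is tangent to it with multiplicity
`ord h ≥ 2`, or `ord h = 1` and both coordinate lines are exceptional (`n_𝓕 = 1`). [HP24 §5 (ii) p. 784] -/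
def IsTangent (E : Finset (Fin 2)) (h : PowerSeries k) : Prop :=
  (1 : Fin 2) ∈ E ∧ h ≠ 0 ∧ ((2 : ℕ∞) ≤ h.order ∨ (0 : Fin 2) ∈ E)

/-! ### Case `n = 0`: exceptional monomial, residual order, `s_𝓕` [HP24 §4 p. 776, §5 p. 783] -/

/-- The exponent of "the unique monomial `M` of maximal degree supported on `E_a` that divides" the (cleaned) coefficient:
`i ↦ ord_{X_i} B` for `i ∈ E`. [HP24 §4 p. 776] -/
noncomputable def excExp (B : MvPowerSeries (Fin 2) k) (E : Finset (Fin 2)) : Fin 2 →₀ ℕ :=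
  ∑ i ∈ E, Finsupp.single i (ordAlong i B).toNat

/-- The RESIDUAL ORDER "`d_res = ord G = ord F − ord_{E_a} F`" of a (cleaned, non-zero) coefficient. [HP24 §4 p. 776] -/
noncomputable def dRes (B : MvPowerSeries (Fin 2) k) (E : Finset (Fin 2)) : ℕ :=
  B.order.toNat - ∑ i ∈ E, (ordAlong i B).toNat

/-- The residual factor `G` of the expansion along an `n = 0` flag: the expansion divided by the exceptional monomial (exact: the shift
`y ↦ y + h(x)` fixes `x`, and `h = 0` when `y` is exceptional). [HP24 §5 p. 783: "F = M·G"] -/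
noncomputable def residual (q : ℕ) (B : MvPowerSeries (Fin 2) k) (E : Finset (Fin 2)) (h : PowerSeries k) :
    MvPowerSeries (Fin 2) k :=
  divMonomial (excExp B E) (expansion q B h)

/-- "`s_𝓕 = ord coeff^{d}(G)` if `d ≥ q` or `d = 0`; `ord coeff^{(q−d)d}((M^d) + (G^{q−d}))` if `0 < d < q`" (companion ideal read as an
ideal sum: minimum of the two coefficient-ideal orders), rows taken with respect to `x = X 0`, the curve letter being `y = X 1`.
[HP24 §5 p. 783; Perlega, arXiv:2011.14443 §3.8] -/
noncomputable def sFlag (q : ℕ) (B : MvPowerSeries (Fin 2) k) (E : Finset (Fin 2)) (h : PowerSeries k) : ℕ∞ :=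
  if q ≤ dRes B E ∨ dRes B E = 0 then coeffIdealOrder (dRes B E) (0 : Fin 2) 1 (residual q B E h)
  else min (coeffIdealOrder ((q - dRes B E) * dRes B E) (0 : Fin 2) 1
      ((monomial (excExp B E) (1 : k)) ^ dRes B E))
    (coeffIdealOrder ((q - dRes B E) * dRes B E) (0 : Fin 2) 1 ((residual q B E h) ^ (q - dRes B E)))

/-! ### Case `n ≥ 1`: weights, `d^curv`, `d_𝓕` [HP24 §5 p. 784] -/

/-- The weights `ω(x) = 1`, `ω(y) = n`. [HP24 §5 p. 784] -/
def weights (n : ℕ) : Fin 2 → ℕ := fun i => if i = (1 : Fin 2) then n else 1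

/-- The weighted order `ord_ω` of the expansion along the flag. [HP24 §5 p. 784] -/
noncomputable def wFlag (q : ℕ) (B : MvPowerSeries (Fin 2) k) (h : PowerSeries k) (n : ℕ) : ℕ∞ :=
  wOrder (weights n) (expansion q B h)

/-- "`d^curv_𝓕 = ord_{F₁} in_ω(F)`": the `y`-order of the weighted initial form of the expansion. [HP24 §5 p. 784] -/
noncomputable def dcurv (q : ℕ) (B : MvPowerSeries (Fin 2) k) (h : PowerSeries k) (n : ℕ) : ℕ∞ :=
  ordAlong (1 : Fin 2) (initialPart (weights n) (expansion q B h))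

/-- "`d_𝓕 = 0` if `0 < d^curv_𝓕 < q` and `q ∣ ord_ω(F)`, `d_𝓕 = d^curv_𝓕` otherwise". [HP24 §5 p. 784] -/
noncomputable def dFlag (q : ℕ) (B : MvPowerSeries (Fin 2) k) (h : PowerSeries k) (n : ℕ) : ℕ :=
  if 0 < (dcurv q B h n).toNat ∧ (dcurv q B h n).toNat < q ∧ q ∣ (wFlag q B h n).toNat then 0 else (dcurv q B h n).toNat

/-! ### The flag triple and the set of flag triples of a state -/

/-- The tangency order `n_𝓕 = ord h` of a tangent flag (as a natural number; `0` for `h = 0`). [HP24 Lemma 1 p. 788: "n_𝓕 = ord h"] -/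
noncomputable def tangency (h : PowerSeries k) : ℕ := h.order.toNat

open Classical in
/-- The flag triple `(d_𝓕, n_𝓕, s_𝓕)` of a flag of the first orientation: `(d_res, 0, s_𝓕)` in case `n = 0`, `(d_𝓕, n_𝓕, 0)` in the
tangent case. [HP24 §5 pp. 783–784] -/
noncomputable def flagTriple (q : ℕ) (B : MvPowerSeries (Fin 2) k) (E : Finset (Fin 2)) (h : PowerSeries k) : Triple :=
  if IsN0 E h then toLex (dRes B E, toLex (0, sFlag q B E h))
  else toLex (dFlag q B h (tangency h), toLex (tangency h, (0 : ℕ∞)))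

/-- `v` IS THE TRIPLE OF AN ADMISSIBLE FLAG of the state `(B, E)`, of either orientation (`o = true`: a flag `V(x + h(y))`, read as a
first-orientation flag of the letter swap). [HP24 §5 p. 784: the flags `𝓕 ∈ F` over which the maximum is taken; Lemma 1 p. 788:
every flag is triangular "after possibly swapping x and y"] -/
def IsFlagTriple (q : ℕ) (B : MvPowerSeries (Fin 2) k) (E : Finset (Fin 2)) (v : Triple) : Prop :=
  ∃ (o : Bool) (h : PowerSeries k), PowerSeries.constantCoeff h = 0 ∧
    (IsN0 (orientE o E) h ∨ IsTangent (orientE o E) h) ∧ v = flagTriple q (orient o B) (orientE o E) h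

/-! ### Terminal shapes and the measure -/

/-- The LITERAL TERMINAL SHAPES of the game's terminal exit (hypothesis `hterm` of the descent lift): monomial times unit with exponent
not in `q·ℕ²`, or `x_i^{qm}·g` with `m > 0` and `0 < ord g < q`. [HP24 §3 p. 775 (monomial case / small residual case), without the
`E_a = ∅` clause: the game's exit is wider] -/
def IsTermShape (q : ℕ) (C : MvPowerSeries (Fin 2) k) : Prop :=
  (∃ (r t : ℕ) (U : MvPowerSeries (Fin 2) k), constantCoeff U ≠ 0 ∧ ¬ (q ∣ r ∧ q ∣ t) ∧
      C = X (0 : Fin 2) ^ r * X (1 : Fin 2) ^ t * U) ∨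
    (∃ (i : Fin 2) (m : ℕ) (g : MvPowerSeries (Fin 2) k), 0 < m ∧ 0 < g.order ∧ g.order < (q : ℕ) ∧ C = X i ^ (q * m) * g)

/-- TERMINAL UP TO A TRIANGULAR CHANGE: along some flag of either orientation the cleaned expansion has a literal terminal shape (the
strategy then plays that change, cleans, and takes the terminal exit). [HP24 §3 p. 775: "there exists a regular system of parameters …
such that one of the following two conditions hold"] -/
def TermSub (q : ℕ) (B : MvPowerSeries (Fin 2) k) : Prop :=
  ∃ (o : Bool) (h : PowerSeries k), PowerSeries.constantCoeff h = 0 ∧ IsTermShape q (expansion q (orient o B) h)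

open Ordinal in
/-- The ordinal `ω²·d + ω·n + s` of a triple (`s = ∞ ↦ ω`): strictly increasing on triples with finite `s`, monotone everywhere. -/
noncomputable def embed (v : Triple) : Ordinal.{0} :=
  ω ^ (2 : ℕ) * ((ofLex v).1 : Ordinal) + ω * ((ofLex (ofLex v).2).1 : Ordinal) +
    (((ofLex (ofLex v).2).2).toNat : Ordinal) + if (ofLex (ofLex v).2).2 = ⊤ then ω else 0

open Classical in
/-- THE MEASURE of a state `(A, E)`: `0` if the cleaned coefficient is terminal up to a triangular change, otherwise the successor of
the supremum of the ordinals of all flag triples (the maximum "`(d, n, s) = max_𝓕 (d_𝓕, n_𝓕, s_𝓕)`" whenever it is attained —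
[HP24, Prop. 3]). [HP24 §5 p. 784] -/
noncomputable def measure (q : ℕ) (A : MvPowerSeries (Fin 2) k) (E : Finset (Fin 2)) : Ordinal.{0} :=
  if TermSub q (cleanSeries q A) then 0
  else Order.succ (⨆ v : {v : Triple // IsFlagTriple q (cleanSeries q A) E v}, embed v.1)

/-! ### Basic facts: the swap symmetry by construction -/

/-- The letter swap is an involution. -/
theorem swap_swap (B : MvPowerSeries (Fin 2) k) : swap (swap B) = B := by
  have h := (renameEquiv k (Equiv.swap (0 : Fin 2) 1)).symm_apply_apply B
  rwa [renameEquiv_symm, Equiv.symm_swap, renameEquiv_apply] at h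

/-- Coefficients of the letter swap. -/
theorem coeff_swap (B : MvPowerSeries (Fin 2) k) (d : Fin 2 →₀ ℕ) :
    coeff d (swap B) = coeff (Finsupp.equivMapDomain (Equiv.swap (0 : Fin 2) 1) d) B := by
  have hd : Finsupp.embDomain (Equiv.swap (0 : Fin 2) 1).toEmbedding
      (Finsupp.equivMapDomain (Equiv.swap (0 : Fin 2) 1) d) = d := by
    rw [Finsupp.embDomain_eq_mapDomain, Equiv.coe_toEmbedding, ← Finsupp.equivMapDomain_eq_mapDomain]
    ext i
    simp only [Finsupp.equivMapDomain_apply, Equiv.symm_swap, Equiv.swap_apply_self]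
  conv_lhs => rw [← hd]
  exact coeff_embDomain_rename (Equiv.swap (0 : Fin 2) 1).toEmbedding B _

/-- The letter swap of exceptional letters is an involution. -/
theorem swapE_swapE (E : Finset (Fin 2)) : swapE (swapE E) = E := by
  unfold swapE
  rw [Finset.map_map]
  have h : ((Equiv.swap (0 : Fin 2) 1).toEmbedding.trans (Equiv.swap (0 : Fin 2) 1).toEmbedding) =
      Function.Embedding.refl _ := by
    ext i
    simp
  rw [h, Finset.map_refl]

/-- Membership in the swapped letter set. -/
theorem mem_swapE (E : Finset (Fin 2)) (i : Fin 2) : i ∈ swapE E ↔ Equiv.swap (0 : Fin 2) 1 i ∈ E := by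
  unfold swapE
  rw [Finset.mem_map_equiv, Equiv.symm_swap]

/-- Orientations compose with the swap: `orient o (swap B) = orient (!o) B`. -/
theorem orient_swap (o : Bool) (B : MvPowerSeries (Fin 2) k) : orient o (swap B) = orient (!o) B := by
  cases o <;> simp [orient, swap_swap]

/-- Orientations compose with the swap on letters. -/
theorem orientE_swapE (o : Bool) (E : Finset (Fin 2)) : orientE o (swapE E) = orientE (!o) E := by
  cases o <;> simp [orientE, swapE_swapE]

/-- THE SET OF FLAG TRIPLES IS SWAP-SYMMETRIC (by construction). -/
theorem isFlagTriple_swap (q : ℕ) (B : MvPowerSeries (Fin 2) k) (E : Finset (Fin 2)) (v : Triple) :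
    IsFlagTriple q (swap B) (swapE E) v ↔ IsFlagTriple q B E v := by
  constructor
  · rintro ⟨o, h, h0, hadm, hv⟩
    refine ⟨!o, h, h0, ?_, ?_⟩
    · rwa [orientE_swapE] at hadm
    · rwa [orient_swap, orientE_swapE] at hv
  · rintro ⟨o, h, h0, hadm, hv⟩
    refine ⟨!o, h, h0, ?_, ?_⟩
    · rwa [orientE_swapE, Bool.not_not]
    · rwa [orient_swap, orientE_swapE, Bool.not_not]

/-- TERMINALITY UP TO A TRIANGULAR CHANGE IS SWAP-SYMMETRIC (by construction). -/
theorem termSub_swap (q : ℕ) (B : MvPowerSeries (Fin 2) k) : TermSub q (swap B) ↔ TermSub q B := by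
  constructor
  · rintro ⟨o, h, h0, hT⟩
    exact ⟨!o, h, h0, by rwa [orient_swap] at hT⟩
  · rintro ⟨o, h, h0, hT⟩
    exact ⟨!o, h, h0, by rwa [orient_swap, Bool.not_not]⟩

open Classical in
/-- Cleaning commutes with the letter swap (the deleted exponent set `q·ℕ²` is symmetric). -/
theorem cleanSeries_swap (q : ℕ) (A : MvPowerSeries (Fin 2) k) : cleanSeries q (swap A) = swap (cleanSeries q A) := by
  ext d
  rw [coeff_cleanSeries, coeff_swap, coeff_swap, coeff_cleanSeries]
  have hiff : (∀ i, q ∣ d i) ↔ ∀ i, q ∣ (Finsupp.equivMapDomain (Equiv.swap (0 : Fin 2) 1) d) i := by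
    simp only [Finsupp.equivMapDomain_apply, Equiv.symm_swap]
    constructor
    · intro H i
      exact H _
    · intro H i
      have := H (Equiv.swap (0 : Fin 2) 1 i)
      rwa [Equiv.swap_apply_self] at this
  by_cases hall : ∀ i, q ∣ d i
  · rw [if_pos hall, if_pos (hiff.mp hall)]
  · rw [if_neg hall, if_neg (fun H => hall (hiff.mpr H))]

/-- THE MEASURE IS SWAP-SYMMETRIC (by construction). -/
theorem measure_swap (q : ℕ) (A : MvPowerSeries (Fin 2) k) (E : Finset (Fin 2)) :
    measure q (swap A) (swapE E) = measure q A E := by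
  unfold measure
  rw [cleanSeries_swap, termSub_swap]
  split_ifs with hT
  · rfl
  · congr 1
    exact (Equiv.subtypeEquivRight (fun v => isFlagTriple_swap q (cleanSeries q A) E v)).iSup_comp
      (g := fun v : {v : Triple // IsFlagTriple q (cleanSeries q A) E v} => embed v.1)

/-! ### Unfolding lemmas -/

/-- `shift h` on the curve letter. -/
theorem shift_one (h : PowerSeries k) :
    shift h (1 : Fin 2) = X (1 : Fin 2) + PowerSeries.subst (X (0 : Fin 2) : MvPowerSeries (Fin 2) k) h := if_pos rfl

/-- `shift h` fixes the row letter. -/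
theorem shift_zero (h : PowerSeries k) : shift h (0 : Fin 2) = X (0 : Fin 2) := if_neg (by decide)

/-- `shift h` is literally the substitution family of `PointBlowupFlagMaximalShift` with `x = 0`, `y = 1`. -/
theorem shift_eq (h : PowerSeries k) : shift h = fun l : Fin 2 => if l = (1 : Fin 2) then
    (X (1 : Fin 2) : MvPowerSeries (Fin 2) k) + PowerSeries.subst (X (0 : Fin 2) : MvPowerSeries (Fin 2) k) h
    else X l := rfl

/-- The shift is substitutable. -/
theorem hasSubst_shift' (h : PowerSeries k) (h0 : PowerSeries.constantCoeff h = 0) : HasSubst (shift h) :=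
  hasSubst_shift (0 : Fin 2) 1 h h0

/-- The orientation selectors, unfolded. -/
@[simp] theorem orient_false (B : MvPowerSeries (Fin 2) k) : orient false B = B := rfl

/-- The orientation selectors, unfolded. -/
@[simp] theorem orient_true (B : MvPowerSeries (Fin 2) k) : orient true B = swap B := rfl

/-- The orientation selectors, unfolded. -/
@[simp] theorem orientE_false (E : Finset (Fin 2)) : orientE false E = E := rfl

/-- The orientation selectors, unfolded. -/
@[simp] theorem orientE_true (E : Finset (Fin 2)) : orientE true E = swapE E := rfl

/-- The triple of an `n = 0` flag. -/
theorem flagTriple_of_isN0 (q : ℕ) (B : MvPowerSeries (Fin 2) k) {E : Finset (Fin 2)} {h : PowerSeries k}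
    (hN : IsN0 E h) : flagTriple q B E h = toLex (dRes B E, toLex (0, sFlag q B E h)) := by
  classical
  exact if_pos hN

/-- The triple of a tangent flag. -/
theorem flagTriple_of_not_isN0 (q : ℕ) (B : MvPowerSeries (Fin 2) k) {E : Finset (Fin 2)} {h : PowerSeries k}
    (hN : ¬ IsN0 E h) : flagTriple q B E h = toLex (dFlag q B h (tangency h), toLex (tangency h, (0 : ℕ∞))) := by
  classical
  exact if_neg hN

/-- A tangent flag is not an `n = 0` flag. -/
theorem IsTangent.not_isN0 {E : Finset (Fin 2)} {h : PowerSeries k} (hT : IsTangent E h) : ¬ IsN0 E h :=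
  fun hN => hN.elim (fun h1 => h1 hT.1) (fun h0 => hT.2.1 h0)

/-- The zero shift is an admissible `n = 0` flag of every state. -/
theorem isFlagTriple_zero (q : ℕ) (B : MvPowerSeries (Fin 2) k) (E : Finset (Fin 2)) :
    IsFlagTriple q B E (flagTriple q B E 0) :=
  ⟨false, 0, map_zero _, Or.inl (Or.inr rfl), rfl⟩

/-- The measure of a terminal state. -/
theorem measure_of_termSub {q : ℕ} {A : MvPowerSeries (Fin 2) k} (E : Finset (Fin 2)) (hT : TermSub q (cleanSeries q A)) :
    measure q A E = 0 := by
  classical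
  exact if_pos hT

/-- The measure of a non-terminal state. -/
theorem measure_of_not_termSub {q : ℕ} {A : MvPowerSeries (Fin 2) k} (E : Finset (Fin 2))
    (hT : ¬ TermSub q (cleanSeries q A)) :
    measure q A E = Order.succ (⨆ v : {v : Triple // IsFlagTriple q (cleanSeries q A) E v}, embed v.1) := by
  classical
  exact if_neg hT

/-- The measure of a non-terminal state is positive. -/
theorem measure_pos_of_not_termSub {q : ℕ} {A : MvPowerSeries (Fin 2) k} (E : Finset (Fin 2))
    (hT : ¬ TermSub q (cleanSeries q A)) : 0 < measure q A E := by
  rw [measure_of_not_termSub E hT]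
  exact Order.lt_succ_of_le zero_le


end PurePowerFlag

end Summit.ResolutionOfSingularities.ResolutionOfSingularities.Theorems
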